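import Summits.Ventures.PercRepro.S2TopFiveHit
import Summits.Ventures.PercRepro.S2CircuitNullity
import Summits.Ventures.PercRepro.S2TwoAvoidingCircuits

/-!
# PercRepro — S2: A TRIANGLE OF A SPREAD CORE MEETS AT MOST THREE OTHER TRIANGLES; THREE PAIRWISE DISJOINT TRIANGLES
(p7, gen 15; sub-claim S2 — the structural lemma of the disjoint-triangles count for the row `p = 13`)

On a spread core (lines of `≤ 3` points, `hC1`; every set of `≤ 9` points has nullity `≤ 3`, `h9`) a triangle `T` meets at most
three other triangles (**`ncard_triangles_meeting_le_three`**). Four triangles `F₁ … F₄` meeting `T` would, by Lemma U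
(`eRk_union_add_ncard_add_one_le`, applied three times: **`eRk_union_four_add_four_le_encard`**), put a set of `≤ 9` points at
nullity `≥ 4` unless each of them lies inside `T ∪` (any two of the others) (**`subset_union_of_triangles_meeting`**); the
containments force `F₁ ∖ T` and `F₂ ∖ T` (two `2`-sets sharing `≤ 1` point) to have their symmetric difference inside both
`F₃ ∖ T` and `F₄ ∖ T`, so `F₃ ∖ T = F₄ ∖ T` — two distinct triangles sharing two points (**`not_four_triangles_meeting`**).
Hence `#𝒯 ≤ 4 + #{triangles disjoint from T}` (**`ncard_triangles_le_four_add_disjoint`**, sharpening g14's `7 +`), and with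
`≥ 9` triangles there are three pairwise disjoint ones (**`exists_three_pairwise_disjoint_triangles_of_nine`**). Nothing about
any cell of `C025` is claimed here. Axioms: standard.
-/

open scoped Matroid

namespace PercRepro

namespace S2

open Set

variable {α : Type}

/-- **Lemma U, four circuits**: the second not inside the first, the third not inside the union of the first two, the fourth
not inside the union of the first three — nullity `≥ 4`: `ρ(C₁ ∪ C₂ ∪ C₃ ∪ C₄) + 4 ≤ |C₁ ∪ C₂ ∪ C₃ ∪ C₄|`. -/
theorem eRk_union_four_add_four_le_encard (M : Matroid α) [M.Finite] {C₁ C₂ C₃ C₄ : Set α}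
    (h₁ : M.IsCircuit C₁) (h₂ : M.IsCircuit C₂) (h₃ : M.IsCircuit C₃) (h₄ : M.IsCircuit C₄)
    (h12 : C₁ ≠ C₂) (h3 : ¬ C₃ ⊆ C₁ ∪ C₂) (h4 : ¬ C₄ ⊆ C₁ ∪ C₂ ∪ C₃) :
    M.eRk (C₁ ∪ C₂ ∪ C₃ ∪ C₄) + 4 ≤ (C₁ ∪ C₂ ∪ C₃ ∪ C₄).encard := by
  have hUfin : (C₁ ∪ C₂ ∪ C₃).Finite :=
    ((M.ground_finite.subset h₁.subset_ground).union (M.ground_finite.subset h₂.subset_ground)).union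
      (M.ground_finite.subset h₃.subset_ground)
  have hUE : C₁ ∪ C₂ ∪ C₃ ⊆ M.E :=
    Set.union_subset (Set.union_subset h₁.subset_ground h₂.subset_ground) h₃.subset_ground
  have hthree := eRk_union_three_add_three_le_encard M h₁ h₂ h₃ h12 h3
  have hstep := eRk_union_add_ncard_add_one_le M hUE h₄ h4
  rw [← hUfin.cast_ncard_eq] at hthree
  rw [← (hUfin.union (M.ground_finite.subset h₄.subset_ground)).cast_ncard_eq]
  obtain ⟨r, hr⟩ := ENat.ne_top_iff_exists.1 (eRk_ne_top_of_finite (M := M) hUE)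
  obtain ⟨r', hr'⟩ := ENat.ne_top_iff_exists.1
    (eRk_ne_top_of_finite (M := M) (Set.union_subset hUE h₄.subset_ground))
  rw [← hr] at hthree
  rw [← hr, ← hr'] at hstep
  rw [← hr']
  have e1 : r + 3 ≤ (C₁ ∪ C₂ ∪ C₃).ncard := by exact_mod_cast hthree
  have e2 : r' + (C₁ ∪ C₂ ∪ C₃).ncard + 1 ≤ r + (C₁ ∪ C₂ ∪ C₃ ∪ C₄).ncard := by exact_mod_cast hstep
  have : r' + 4 ≤ (C₁ ∪ C₂ ∪ C₃ ∪ C₄).ncard := by omega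
  exact_mod_cast this

/-- Two distinct triangles share at most one point: `|F ∩ F'| ≤ 1`. -/
theorem ncard_inter_le_one_of_triangles (M : Matroid α) [M.Finite]
    (hC1 : ∀ L ⊆ M.E, M.eRk L = 2 → L.ncard ≤ 3)
    {F F' : Set α} (hF : M.IsCircuit F) (hF3 : F.ncard = 3) (hF' : M.IsCircuit F') (hF'3 : F'.ncard = 3)
    (hne : F ≠ F') : (F ∩ F').ncard ≤ 1 := by
  have hFfin : F.Finite := M.ground_finite.subset hF.subset_ground
  have hF'fin : F'.Finite := M.ground_finite.subset hF'.subset_ground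
  have h5 := five_le_ncard_union_of_triangles M hC1 hF hF3 hF' hF'3 hne
  have h := Set.ncard_union_add_ncard_inter F F' hFfin hF'fin
  omega

/-- A triangle `F ≠ T` meeting the triangle `T` has exactly two points outside `T`: `|F ∖ T| = 2`. -/
theorem ncard_sdiff_eq_two_of_triangles_meeting (M : Matroid α) [M.Finite]
    (hC1 : ∀ L ⊆ M.E, M.eRk L = 2 → L.ncard ≤ 3)
    {T F : Set α} (hT : M.IsCircuit T) (hT3 : T.ncard = 3) (hF : M.IsCircuit F) (hF3 : F.ncard = 3)
    (hne : F ≠ T) (hmeet : ¬ Disjoint F T) : (F \ T).ncard = 2 := by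
  have hFfin : F.Finite := M.ground_finite.subset hF.subset_ground
  obtain ⟨x, hxF, hxT⟩ := Set.not_disjoint_iff.1 hmeet
  have hinter : F ∩ T = {x} := inter_eq_singleton_of_triangles_through M hC1 hF hF3 hT hT3 hne hxF hxT
  have h := Set.ncard_inter_add_ncard_sdiff_eq_ncard F T hFfin
  rw [hinter, Set.ncard_singleton] at h
  omega

/-- Two distinct triangles `F`, `F'` meeting `T` (both `≠ T`): `F` is not inside `T ∪ F'`
(its two points outside `T` would both lie on `F'`). -/
theorem not_subset_union_of_triangles_meeting (M : Matroid α) [M.Finite]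
    (hC1 : ∀ L ⊆ M.E, M.eRk L = 2 → L.ncard ≤ 3)
    {T F F' : Set α} (hT : M.IsCircuit T) (hT3 : T.ncard = 3)
    (hF : M.IsCircuit F) (hF3 : F.ncard = 3) (hFT : F ≠ T) (hFm : ¬ Disjoint F T)
    (hF' : M.IsCircuit F') (hF'3 : F'.ncard = 3) (hne : F ≠ F') : ¬ F ⊆ T ∪ F' := by
  intro hsub
  have hFfin : F.Finite := M.ground_finite.subset hF.subset_ground
  have h2 := ncard_sdiff_eq_two_of_triangles_meeting M hC1 hT hT3 hF hF3 hFT hFm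
  have hsub' : F \ T ⊆ F ∩ F' := by
    intro y hy
    refine ⟨hy.1, ?_⟩
    rcases hsub hy.1 with h | h
    · exact absurd h hy.2
    · exact h
  have h1 := ncard_inter_le_one_of_triangles M hC1 hF hF3 hF' hF'3 hne
  have := Set.ncard_le_ncard hsub' (hFfin.subset Set.inter_subset_left)
  omega

/-- **The containment forced by the spread hypothesis**: two distinct triangles `G₁ ≠ G₂` and a triangle `G₃`, all meeting `T` (all `≠ T`), satisfy
`G₃ ⊆ T ∪ G₁ ∪ G₂` — otherwise Lemma U puts `T ∪ G₁ ∪ G₂ ∪ G₃` (at most `9` points) at nullity `≥ 4`. -/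
theorem subset_union_of_triangles_meeting (M : Matroid α) [M.Finite]
    (hC1 : ∀ L ⊆ M.E, M.eRk L = 2 → L.ncard ≤ 3)
    (h9 : ∀ X ⊆ M.E, X.ncard ≤ 9 → X.encard ≤ M.eRk X + 3)
    {T G₁ G₂ G₃ : Set α} (hT : M.IsCircuit T) (hT3 : T.ncard = 3)
    (hG₁ : M.IsCircuit G₁) (hG₁3 : G₁.ncard = 3) (hG₁T : G₁ ≠ T) (hG₁m : ¬ Disjoint G₁ T)
    (hG₂ : M.IsCircuit G₂) (hG₂3 : G₂.ncard = 3) (hG₂T : G₂ ≠ T) (hG₂m : ¬ Disjoint G₂ T)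
    (hG₃ : M.IsCircuit G₃) (hG₃3 : G₃.ncard = 3) (hG₃T : G₃ ≠ T) (hG₃m : ¬ Disjoint G₃ T)
    (h12 : G₁ ≠ G₂) : G₃ ⊆ T ∪ G₁ ∪ G₂ := by
  by_contra hnot
  have hTfin : T.Finite := M.ground_finite.subset hT.subset_ground
  have hG₁fin : G₁.Finite := M.ground_finite.subset hG₁.subset_ground
  have hG₂fin : G₂.Finite := M.ground_finite.subset hG₂.subset_ground
  have hG₃fin : G₃.Finite := M.ground_finite.subset hG₃.subset_ground
  have hnot2 : ¬ G₂ ⊆ T ∪ G₁ :=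
    not_subset_union_of_triangles_meeting M hC1 hT hT3 hG₂ hG₂3 hG₂T hG₂m hG₁ hG₁3 (Ne.symm h12)
  have h4 := eRk_union_four_add_four_le_encard M hT hG₁ hG₂ hG₃ (Ne.symm hG₁T) hnot2 hnot
  set X := T ∪ G₁ ∪ G₂ ∪ G₃ with hX
  have hXE : X ⊆ M.E :=
    Set.union_subset (Set.union_subset (Set.union_subset hT.subset_ground hG₁.subset_ground)
      hG₂.subset_ground) hG₃.subset_ground
  -- `|X| ≤ 3 + 2 + 2 + 2`
  have hX9 : X.ncard ≤ 9 := by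
    have e1 := ncard_sdiff_eq_two_of_triangles_meeting M hC1 hT hT3 hG₁ hG₁3 hG₁T hG₁m
    have e2 := ncard_sdiff_eq_two_of_triangles_meeting M hC1 hT hT3 hG₂ hG₂3 hG₂T hG₂m
    have e3 := ncard_sdiff_eq_two_of_triangles_meeting M hC1 hT hT3 hG₃ hG₃3 hG₃T hG₃m
    have hsub : X ⊆ T ∪ (G₁ \ T) ∪ (G₂ \ T) ∪ (G₃ \ T) := by
      intro y hy
      simp only [hX, Set.mem_union, Set.mem_sdiff] at hy ⊢
      tauto
    have hfin : (T ∪ (G₁ \ T) ∪ (G₂ \ T) ∪ (G₃ \ T)).Finite :=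
      ((hTfin.union (hG₁fin.subset Set.sdiff_subset)).union (hG₂fin.subset Set.sdiff_subset)).union
        (hG₃fin.subset Set.sdiff_subset)
    have hle := Set.ncard_le_ncard hsub hfin
    have u1 := Set.ncard_union_le (T ∪ (G₁ \ T) ∪ (G₂ \ T)) (G₃ \ T)
    have u2 := Set.ncard_union_le (T ∪ (G₁ \ T)) (G₂ \ T)
    have u3 := Set.ncard_union_le T (G₁ \ T)
    omega
  have h9X := h9 X hXE hX9
  obtain ⟨r, hr⟩ := ENat.ne_top_iff_exists.1 (eRk_ne_top_of_finite (M := M) hXE)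
  rw [← hr] at h4
  rw [← hr] at h9X
  have hbad : (r : ℕ∞) + 4 ≤ r + 3 := h4.trans h9X
  have : r + 4 ≤ r + 3 := by exact_mod_cast hbad
  omega

/-- **At most three triangles meet a triangle `T` on a spread core**: four distinct triangles `F₁ … F₄` meeting `T`
(all `≠ T`) are impossible. -/
theorem not_four_triangles_meeting (M : Matroid α) [M.Finite]
    (hC1 : ∀ L ⊆ M.E, M.eRk L = 2 → L.ncard ≤ 3)
    (h9 : ∀ X ⊆ M.E, X.ncard ≤ 9 → X.encard ≤ M.eRk X + 3)
    {T F₁ F₂ F₃ F₄ : Set α} (hT : M.IsCircuit T) (hT3 : T.ncard = 3)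
    (h₁ : M.IsCircuit F₁) (h₁c : F₁.ncard = 3) (h₁T : F₁ ≠ T) (h₁m : ¬ Disjoint F₁ T)
    (h₂ : M.IsCircuit F₂) (h₂c : F₂.ncard = 3) (h₂T : F₂ ≠ T) (h₂m : ¬ Disjoint F₂ T)
    (h₃ : M.IsCircuit F₃) (h₃c : F₃.ncard = 3) (h₃T : F₃ ≠ T) (h₃m : ¬ Disjoint F₃ T)
    (h₄ : M.IsCircuit F₄) (h₄c : F₄.ncard = 3) (h₄T : F₄ ≠ T) (h₄m : ¬ Disjoint F₄ T)
    (h12 : F₁ ≠ F₂) (h13 : F₁ ≠ F₃) (h14 : F₁ ≠ F₄) (h23 : F₂ ≠ F₃) (h24 : F₂ ≠ F₄) (h34 : F₃ ≠ F₄) : False := by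
  have h₁fin : F₁.Finite := M.ground_finite.subset h₁.subset_ground
  have h₂fin : F₂.Finite := M.ground_finite.subset h₂.subset_ground
  have h₃fin : F₃.Finite := M.ground_finite.subset h₃.subset_ground
  have h₄fin : F₄.Finite := M.ground_finite.subset h₄.subset_ground
  -- the four containments
  have c1 : F₁ ⊆ T ∪ F₃ ∪ F₂ :=
    subset_union_of_triangles_meeting M hC1 h9 hT hT3 h₃ h₃c h₃T h₃m h₂ h₂c h₂T h₂m h₁ h₁c h₁T h₁m
      (Ne.symm h23)
  have c2 : F₂ ⊆ T ∪ F₃ ∪ F₁ :=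
    subset_union_of_triangles_meeting M hC1 h9 hT hT3 h₃ h₃c h₃T h₃m h₁ h₁c h₁T h₁m h₂ h₂c h₂T h₂m
      (Ne.symm h13)
  have c3 : F₁ ⊆ T ∪ F₄ ∪ F₂ :=
    subset_union_of_triangles_meeting M hC1 h9 hT hT3 h₄ h₄c h₄T h₄m h₂ h₂c h₂T h₂m h₁ h₁c h₁T h₁m
      (Ne.symm h24)
  have c4 : F₂ ⊆ T ∪ F₄ ∪ F₁ :=
    subset_union_of_triangles_meeting M hC1 h9 hT hT3 h₄ h₄c h₄T h₄m h₁ h₁c h₁T h₁m h₂ h₂c h₂T h₂m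
      (Ne.symm h14)
  -- the points outside `T`
  set P₁ := F₁ \ T with hP₁
  set P₂ := F₂ \ T with hP₂
  set P₃ := F₃ \ T with hP₃
  set P₄ := F₄ \ T with hP₄
  have e1 : P₁.ncard = 2 := ncard_sdiff_eq_two_of_triangles_meeting M hC1 hT hT3 h₁ h₁c h₁T h₁m
  have e2 : P₂.ncard = 2 := ncard_sdiff_eq_two_of_triangles_meeting M hC1 hT hT3 h₂ h₂c h₂T h₂m
  have e3 : P₃.ncard = 2 := ncard_sdiff_eq_two_of_triangles_meeting M hC1 hT hT3 h₃ h₃c h₃T h₃m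
  have e4 : P₄.ncard = 2 := ncard_sdiff_eq_two_of_triangles_meeting M hC1 hT hT3 h₄ h₄c h₄T h₄m
  -- the symmetric difference `D = (P₁ ∖ P₂) ∪ (P₂ ∖ P₁)` lies inside `P₃` and inside `P₄`
  set D := (P₁ \ P₂) ∪ (P₂ \ P₁) with hD
  have hD3 : D ⊆ P₃ := by
    intro y hy
    simp only [hD, hP₁, hP₂, hP₃, Set.mem_union, Set.mem_sdiff, not_and, not_not] at hy ⊢
    rcases hy with ⟨⟨hy1, hyT⟩, hy2⟩ | ⟨⟨hy2, hyT⟩, hy1⟩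
    · refine ⟨?_, hyT⟩
      rcases c1 hy1 with (h | h) | h
      · exact absurd h hyT
      · exact h
      · exact absurd h (fun h' => hyT (hy2 h'))
    · refine ⟨?_, hyT⟩
      rcases c2 hy2 with (h | h) | h
      · exact absurd h hyT
      · exact h
      · exact absurd h (fun h' => hyT (hy1 h'))
  have hD4 : D ⊆ P₄ := by
    intro y hy
    simp only [hD, hP₁, hP₂, hP₄, Set.mem_union, Set.mem_sdiff, not_and, not_not] at hy ⊢
    rcases hy with ⟨⟨hy1, hyT⟩, hy2⟩ | ⟨⟨hy2, hyT⟩, hy1⟩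
    · refine ⟨?_, hyT⟩
      rcases c3 hy1 with (h | h) | h
      · exact absurd h hyT
      · exact h
      · exact absurd h (fun h' => hyT (hy2 h'))
    · refine ⟨?_, hyT⟩
      rcases c4 hy2 with (h | h) | h
      · exact absurd h hyT
      · exact h
      · exact absurd h (fun h' => hyT (hy1 h'))
  -- `|D| = 4 − 2 |P₁ ∩ P₂| ≥ 2`
  have hP₁fin : P₁.Finite := h₁fin.subset Set.sdiff_subset
  have hP₂fin : P₂.Finite := h₂fin.subset Set.sdiff_subset
  have hP₃fin : P₃.Finite := h₃fin.subset Set.sdiff_subset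
  have hP₄fin : P₄.Finite := h₄fin.subset Set.sdiff_subset
  have hi : (P₁ ∩ P₂).ncard ≤ 1 := by
    have hsub : P₁ ∩ P₂ ⊆ F₁ ∩ F₂ := Set.inter_subset_inter Set.sdiff_subset Set.sdiff_subset
    have := Set.ncard_le_ncard hsub (h₁fin.subset Set.inter_subset_left)
    have h1 := ncard_inter_le_one_of_triangles M hC1 h₁ h₁c h₂ h₂c h12
    omega
  have hs1 := Set.ncard_inter_add_ncard_sdiff_eq_ncard P₁ P₂ hP₁fin
  have hs2 := Set.ncard_inter_add_ncard_sdiff_eq_ncard P₂ P₁ hP₂fin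
  rw [Set.inter_comm] at hs2
  have hDcard : D.ncard = (P₁ \ P₂).ncard + (P₂ \ P₁).ncard :=
    Set.ncard_union_eq disjoint_sdiff_sdiff (hP₁fin.subset Set.sdiff_subset) (hP₂fin.subset Set.sdiff_subset)
  have hD3c := Set.ncard_le_ncard hD3 hP₃fin
  -- so `|P₁ ∩ P₂| = 1`, `|D| = 2`, and `D = P₃ = P₄`
  have hD2 : D.ncard = 2 := by omega
  have hDP₃ : D = P₃ := Set.eq_of_subset_of_ncard_le hD3 (by omega) hP₃fin
  have hDP₄ : D = P₄ := Set.eq_of_subset_of_ncard_le hD4 (by omega) hP₄fin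
  -- two distinct triangles `F₃ ≠ F₄` sharing the two points of `P₃ = P₄`
  have hsub : P₃ ⊆ F₃ ∩ F₄ := by
    intro y hy
    exact ⟨hy.1, (hDP₄ ▸ (hDP₃.symm ▸ hy : y ∈ D) : y ∈ P₄).1⟩
  have h1 := ncard_inter_le_one_of_triangles M hC1 h₃ h₃c h₄ h₄c h34
  have := Set.ncard_le_ncard hsub (h₃fin.subset Set.inter_subset_left)
  omega

/-- **At most three other triangles meet a triangle `T`** on a spread core. -/
theorem ncard_triangles_meeting_le_three (M : Matroid α) [M.Finite]
    (hC1 : ∀ L ⊆ M.E, M.eRk L = 2 → L.ncard ≤ 3)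
    (h9 : ∀ X ⊆ M.E, X.ncard ≤ 9 → X.encard ≤ M.eRk X + 3)
    {T : Set α} (hT : M.IsCircuit T) (hT3 : T.ncard = 3) :
    {C : Set α | M.IsCircuit C ∧ C.ncard = 3 ∧ C ≠ T ∧ ¬ Disjoint C T}.ncard ≤ 3 := by
  by_contra hlt
  push Not at hlt
  have hfin : {C : Set α | M.IsCircuit C ∧ C.ncard = 3 ∧ C ≠ T ∧ ¬ Disjoint C T}.Finite :=
    M.ground_finite.finite_subsets.subset (fun C hC => hC.1.subset_ground)
  obtain ⟨F₁, F₂, F₃, F₄, h₁, h₂, h₃, h₄, h12, h13, h14, h23, h24, h34⟩ := (Set.three_lt_ncard_iff hfin).1 hlt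
  exact not_four_triangles_meeting M hC1 h9 hT hT3 h₁.1 h₁.2.1 h₁.2.2.1 h₁.2.2.2 h₂.1 h₂.2.1 h₂.2.2.1 h₂.2.2.2
    h₃.1 h₃.2.1 h₃.2.2.1 h₃.2.2.2 h₄.1 h₄.2.1 h₄.2.2.1 h₄.2.2.2 h12 h13 h14 h23 h24 h34

/-- **`#𝒯 ≤ 4 + #{triangles disjoint from T}`** on a spread core (every triangle is `T`, meets `T`, or avoids `T`). -/
theorem ncard_triangles_le_four_add_disjoint (M : Matroid α) [M.Finite]
    (hC1 : ∀ L ⊆ M.E, M.eRk L = 2 → L.ncard ≤ 3)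
    (h9 : ∀ X ⊆ M.E, X.ncard ≤ 9 → X.encard ≤ M.eRk X + 3)
    {T : Set α} (hT : M.IsCircuit T) (hT3 : T.ncard = 3) :
    {C : Set α | M.IsCircuit C ∧ C.ncard = 3}.ncard ≤
      4 + {C : Set α | M.IsCircuit C ∧ C.ncard = 3 ∧ Disjoint C T}.ncard := by
  classical
  set 𝒯 := {C : Set α | M.IsCircuit C ∧ C.ncard = 3} with h𝒯
  have h𝒯fin : 𝒯.Finite := M.ground_finite.finite_subsets.subset (fun C hC => hC.1.subset_ground)
  set 𝒩 := {C : Set α | M.IsCircuit C ∧ C.ncard = 3 ∧ C ≠ T ∧ ¬ Disjoint C T} with h𝒩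
  set 𝒟 := {C : Set α | M.IsCircuit C ∧ C.ncard = 3 ∧ Disjoint C T} with h𝒟
  have h𝒩fin : 𝒩.Finite := h𝒯fin.subset (fun C hC => ⟨hC.1, hC.2.1⟩)
  have h𝒟fin : 𝒟.Finite := h𝒯fin.subset (fun C hC => ⟨hC.1, hC.2.1⟩)
  have h3 : 𝒩.ncard ≤ 3 := ncard_triangles_meeting_le_three M hC1 h9 hT hT3
  have hcover : 𝒯 ⊆ ({T} ∪ 𝒩) ∪ 𝒟 := by
    intro T' hT'
    by_cases hne : T' = T
    · exact Or.inl (Or.inl (Set.mem_singleton_iff.2 hne))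
    by_cases hdis : Disjoint T' T
    · exact Or.inr ⟨hT'.1, hT'.2, hdis⟩
    · exact Or.inl (Or.inr ⟨hT'.1, hT'.2, hne, hdis⟩)
  have hle := Set.ncard_le_ncard hcover (((Set.finite_singleton T).union h𝒩fin).union h𝒟fin)
  have hu1 := Set.ncard_union_le ({T} ∪ 𝒩) 𝒟
  have hu2 := Set.ncard_union_le ({T} : Set (Set α)) 𝒩
  rw [Set.ncard_singleton] at hu2
  omega

/-- **With `≥ 9` triangles a spread core has three pairwise disjoint triangles.** -/
theorem exists_three_pairwise_disjoint_triangles_of_nine (M : Matroid α) [M.Finite]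
    (hC1 : ∀ L ⊆ M.E, M.eRk L = 2 → L.ncard ≤ 3)
    (h9 : ∀ X ⊆ M.E, X.ncard ≤ 9 → X.encard ≤ M.eRk X + 3)
    (h9t : 9 ≤ {C : Set α | M.IsCircuit C ∧ C.ncard = 3}.ncard) :
    ∃ T₁ T₂ T₃ : Set α, M.IsCircuit T₁ ∧ T₁.ncard = 3 ∧ M.IsCircuit T₂ ∧ T₂.ncard = 3 ∧
      M.IsCircuit T₃ ∧ T₃.ncard = 3 ∧ Disjoint T₁ T₂ ∧ Disjoint T₁ T₃ ∧ Disjoint T₂ T₃ := by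
  classical
  set 𝒯 := {C : Set α | M.IsCircuit C ∧ C.ncard = 3} with h𝒯
  have h𝒯fin : 𝒯.Finite := M.ground_finite.finite_subsets.subset (fun C hC => hC.1.subset_ground)
  -- a first triangle
  obtain ⟨T₁, hT₁⟩ : 𝒯.Nonempty := Set.nonempty_of_ncard_ne_zero (by omega)
  -- the triangles disjoint from `T₁`: at least `5`
  set 𝒟₁ := {C : Set α | M.IsCircuit C ∧ C.ncard = 3 ∧ Disjoint C T₁} with h𝒟₁
  have h𝒟₁fin : 𝒟₁.Finite := h𝒯fin.subset (fun C hC => ⟨hC.1, hC.2.1⟩)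
  have h5 : 5 ≤ 𝒟₁.ncard := by
    have h4 : 𝒯.ncard ≤ 4 + 𝒟₁.ncard := ncard_triangles_le_four_add_disjoint M hC1 h9 hT₁.1 hT₁.2
    omega
  obtain ⟨T₂, hT₂⟩ : 𝒟₁.Nonempty := Set.nonempty_of_ncard_ne_zero (by omega)
  -- the triangles of `𝒟₁` other than `T₂` and disjoint from `T₂`: `𝒟₁ ⊆ {T₂} ∪ 𝒩₂ ∪ (𝒟₁ ∩ 𝒟₂)`
  set 𝒩₂ := {C : Set α | M.IsCircuit C ∧ C.ncard = 3 ∧ C ≠ T₂ ∧ ¬ Disjoint C T₂} with h𝒩₂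
  have h𝒩₂fin : 𝒩₂.Finite := h𝒯fin.subset (fun C hC => ⟨hC.1, hC.2.1⟩)
  have h3 : 𝒩₂.ncard ≤ 3 := ncard_triangles_meeting_le_three M hC1 h9 hT₂.1 hT₂.2.1
  set 𝒟₁₂ := {C : Set α | M.IsCircuit C ∧ C.ncard = 3 ∧ Disjoint C T₁ ∧ Disjoint C T₂} with h𝒟₁₂
  have h𝒟₁₂fin : 𝒟₁₂.Finite := h𝒯fin.subset (fun C hC => ⟨hC.1, hC.2.1⟩)
  have hcover : 𝒟₁ ⊆ ({T₂} ∪ 𝒩₂) ∪ 𝒟₁₂ := by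
    intro C hC
    by_cases hne : C = T₂
    · exact Or.inl (Or.inl (Set.mem_singleton_iff.2 hne))
    by_cases hdis : Disjoint C T₂
    · exact Or.inr ⟨hC.1, hC.2.1, hC.2.2, hdis⟩
    · exact Or.inl (Or.inr ⟨hC.1, hC.2.1, hne, hdis⟩)
  have hle := Set.ncard_le_ncard hcover (((Set.finite_singleton T₂).union h𝒩₂fin).union h𝒟₁₂fin)
  have hu1 := Set.ncard_union_le ({T₂} ∪ 𝒩₂) 𝒟₁₂
  have hu2 := Set.ncard_union_le ({T₂} : Set (Set α)) 𝒩₂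
  rw [Set.ncard_singleton] at hu2
  obtain ⟨T₃, hT₃⟩ : 𝒟₁₂.Nonempty := Set.nonempty_of_ncard_ne_zero (by omega)
  exact ⟨T₁, T₂, T₃, hT₁.1, hT₁.2, hT₂.1, hT₂.2.1, hT₃.1, hT₃.2.1, hT₂.2.2.symm, hT₃.2.2.1.symm, hT₃.2.2.2.symm⟩

end S2

end PercRepro
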